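import Summits.AtomisticToContinuum.Crystallization.Theorems.ThreeConeCertificateSlackRigidityPricedFloorsStationarity
import Summits.AtomisticToContinuum.Crystallization.Theorems.ThreeConeCertificateSlackRigidityPricedFloorsProb
import Summits.AtomisticToContinuum.Crystallization.Theorems.PalmUnimodularRigidityMinimiserShellsEnergyFloorC
import HarnessLib

/-!
# `SlackRigidity` (stmt-AtomisticToContinuum-11960), line `priced-floors-palm-exactification`, stub S3
# (`stub_layeredMeanSelection`): the mean fault-exclusion argument (probabilistic assembly, abstract)

Lead c19, S3 probabilistic core, part 3.  THE SELECTION-IN-MEAN MECHANISM, with every geometric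
input abstracted into a hypothesis (they are the registered sub-goals of the line):

Let `P` be a minimising point-stationary law (`E_P[h] ≤ e*`), `H = 2h` the (doubled) root energy,
`Hc` a bounded measurable "competitor energy" functional and `F ≥ 0` a bounded measurable "fault"
functional, PRICED by `c · F ≤ H − Hc` almost surely (the per-site registry price of a stacking
fault, `lms_fault_price_symmetric`).  Suppose that for every `n` there is a transport kernel pair
`(Ωr n, Ωs n)` (balance + covariance, `lms_lintegral_eq_transport`) under which the transported
competitor energy is pointwise at least `2e* − C/(2n+1)` (the window bound `lms_window_sum_ge` read
through the layer transport over the `2n+1` layers around the root).  Then `E_P[Hc] ≥ 2e*`, while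
`E_P[H] ≤ 2e*`, so `F = 0` almost surely: NO STACKING FAULT NEXT TO THE ROOT'S LAYER.

Registered sub-goal `lms_faults_ae_zero`.  All `[folklore]`.
-/

noncomputable section

open MeasureTheory Filter Set
open scoped ENNReal BigOperators Topology

namespace Summit.AtomisticToContinuum.Crystallization.Theorems.SlackRigidityPricedFloorsFaults

open Literature.Probability.Process
open Literature.MathematicalPhysics.StatisticalMechanics
open Summit.AtomisticToContinuum.Crystallization.Theorems.SlackRigidityPricedFloors
open Summit.AtomisticToContinuum.Crystallization.Theorems.SlackRigidityPricedFloorsStationarity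
open Summit.AtomisticToContinuum.Crystallization.Theorems.SlackRigidityPricedFloorsProb
open Summit.AtomisticToContinuum.Crystallization.Theorems.MinimiserShells.Negative.LoadBearing (eStar)
open Summit.AtomisticToContinuum.Crystallization.Theorems.PalmUnimodularRigidityMinimiserShells.EnergyFloor
  (rootEnergy' measurable_rootEnergy' rootEnergy'_eq_of_hc rootEnergy'_bounds_of_hc)

/-- A real number exceeding `b − C/(2n+1)` for every `n` is at least `b` (`C ≥ 0`). [folklore] -/
theorem le_of_forall_sub_div {x b C : ℝ} (hC : 0 ≤ C) (h : ∀ n : ℕ, b - C / (2 * n + 1) ≤ x) : b ≤ x := by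
  refine le_of_forall_pos_le_add fun ε hε => ?_
  obtain ⟨n, hn⟩ := exists_nat_gt (C / ε)
  have h1 := h n
  have hpos : (0 : ℝ) < 2 * n + 1 := by positivity
  have : C / (2 * n + 1) ≤ ε := by
    rw [div_le_iff₀ hpos]
    rw [div_lt_iff₀ hε] at hn
    nlinarith
  linarith

/-- **Mean fault exclusion** (registered sub-goal `lms_faults_ae_zero`): see the module docstring.
[folklore] -/
theorem lms_faults_ae_zero : ∀ (δ : ℝ), 0 < δ → ∀ (P : Measure (Measure E3)), IsProbabilityMeasure P → IsMinimisingLaw δ P → ∀ (Hc F : Measure E3 → ℝ), Measurable Hc → Measurable F → ∀ (K c C : ℝ), 0 < c → 0 ≤ C → (∀ᵐ μ ∂P, |Hc μ| ≤ K) → (∀ᵐ μ ∂P, 0 ≤ F μ ∧ F μ ≤ K) → (∀ᵐ μ ∂P, c * F μ ≤ 2 * rootEnergy lennardJones μ - Hc μ) → (∀ n : ℕ, ∃ Ωr Ωs : Measure E3 → E3 → ℝ≥0∞, Measurable (Function.uncurry Ωr) ∧ (∀ᵐ μ ∂P, ∫⁻ y, Ωr μ y ∂μ = 1) ∧ (∀ᵐ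 μ ∂P, ∀ y : E3, μ {y} ≠ 0 → Ωr (μ.map (fun z => z - y)) (-y) = Ωs μ y) ∧ (∀ᵐ μ ∂P, ENNReal.ofReal (2 * eStar - C / (2 * n + 1) + K) ≤ ∫⁻ y, Ωs μ y * ENNReal.ofReal (Hc (μ.map (fun z => z - y)) + K) ∂μ)) → ∀ᵐ μ ∂P, F μ = 0 := by
  intro δ hδ P hP hlaw Hc F hHcm hFm K c C hc hC hHcK hFK hprice hT
  obtain ⟨hcore, hstat, hE⟩ := hlaw
  -- the doubled root energy as a measurable functional
  set H : Measure E3 → ℝ := fun μ => 2 * rootEnergy' μ with hHdef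
  have hHm : Measurable H := measurable_rootEnergy'.const_mul 2
  have hHeq : ∀ᵐ μ ∂P, H μ = 2 * rootEnergy lennardJones μ := by
    filter_upwards [hcore] with μ hμ
    simp only [hHdef, rootEnergy'_eq_of_hc hδ hμ, rootEnergy_def]
  -- bounds
  set K' : ℝ := max K (2 * (250 / 12 * δ⁻¹ ^ 6 + 250 / 24 * δ⁻¹ ^ 12)) with hK'def
  have hKK' : K ≤ K' := le_max_left _ _
  have hHb : ∀ᵐ μ ∂P, |H μ| ≤ K' := by
    filter_upwards [hcore] with μ hμ
    obtain ⟨h1, h2⟩ := rootEnergy'_bounds_of_hc hδ hμ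
    refine le_trans ?_ (le_max_right _ _)
    rw [abs_le]
    simp only [hHdef]
    constructor <;> nlinarith [h1, h2, show (0 : ℝ) ≤ δ⁻¹ ^ 6 by positivity, show (0 : ℝ) ≤ δ⁻¹ ^ 12 by positivity]
  have hHcb : ∀ᵐ μ ∂P, |Hc μ| ≤ K' := by
    filter_upwards [hHcK] with μ hμ using hμ.trans hKK'
  have hFb : ∀ᵐ μ ∂P, 0 ≤ F μ ∧ F μ ≤ K' := by
    filter_upwards [hFK] with μ hμ using ⟨hμ.1, hμ.2.trans hKK'⟩
  -- `E[H] ≤ 2 e*`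
  have hHint : Integrable H P := integrable_of_abs_le hHm hHb
  have hHE : ∫ μ, H μ ∂P ≤ 2 * eStar := by
    rw [integral_congr_ae hHeq, integral_const_mul]
    linarith
  -- `E[Hc] ≥ 2 e*` by the transport identities and the window bound
  have hHcE : 2 * eStar ≤ ∫ μ, Hc μ ∂P := by
    refine le_of_forall_sub_div hC fun n => ?_
    obtain ⟨Ωr, Ωs, hΩm, hbal, hcov, hid⟩ := hT n
    have htr := lms_lintegral_eq_transport δ hδ P hstat hcore Ωr Ωs hΩm hbal hcov
      (fun μ => ENNReal.ofReal (Hc μ + K)) (ENNReal.measurable_ofReal.comp (hHcm.add_const K))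
    exact integral_ge_of_transport hHcm hHcK htr hid
  -- the price, with `H` in place of `2h`
  have hprice' : ∀ᵐ μ ∂P, c * F μ ≤ H μ - Hc μ := by
    filter_upwards [hprice, hHeq] with μ h1 h2
    rwa [h2]
  exact lms_ae_eq_zero_of_price P hP F H Hc hFm hHm hHcm K' c (2 * eStar) hc hFb hHb hHcb hprice' hHE hHcE

end Summit.AtomisticToContinuum.Crystallization.Theorems.SlackRigidityPricedFloorsFaults

end
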